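import Mathlib
import Literature.Probability.Percolation.PercolationProofs
import Literature.Probability.LatticeModels.ProdBernoulliIndependence
import Literature.Probability.LatticeModels.ProdBernoulliClusterLocality
import Literature.Probability.LatticeModels.ProdBernoulliCoupling
import Literature.Probability.Percolation.KozmaNitzanPinning
import Summits.CriticalPhenomena.PercolationContinuityZ3.Theorems.PercNearOneGluingAdditiveGluingLemma5AnyRelay
import Summits.CriticalPhenomena.PercolationContinuityZ3.Theorems.PercNearOneGluingAdditiveGluingGoodBase
import Summits.CriticalPhenomena.PercolationContinuityZ3.Theorems.PercNearOneGluingAdditiveGluingGoodStep24Engine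
import HarnessLib

/-! # Crux `PercNearOneGluing.AdditiveGluing` (stmt-CriticalPhenomena-4576), line `subuniform-dead-pocket-maximum`, stub `stub_goodStep` — the branch inequalities (siege k24)

Support file for the inductive step `stub_goodStep`; proves the registered helper stub
`stub_goodStepBranch_k24` and lands `--supports stmt-CriticalPhenomena-4576`.

## Content

The σ-engine `stub_goodStepEngine_k24` (file `…GoodStep24Engine.lean`) reduces goodness of a
low-only observer `o` to one inequality per layer `S` of the open star of `o`, stated for the
branch graph `G⁰/S` (`G⁰` = the star of `o` killed, `S` glued) with a FIXED relay `a₀`.  Here the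
three kinds of layers are discharged / normalised:

* `goodStep24_ker_empty` — the empty layer (`o` isolated): the inequality is the minimality of
  `a₀` for `μ_{G⁰}(· ↔ b)` over `A` (`{C(o) = {o}}` is the only pocket; "killing the star is
  deleting `o`", `lemma5AnyRelay_real_openConnIn_compl_eq`).
* `stub_goodStepBranch_k24` (**registered**) — a general layer `S ∌ o`: the engine's inequality
  (pockets indexed by `W ∋ o`, two-point factors in the ambient weighting) follows from the CLEAN
  glued-goodness inequality of `(G⁰, S)` (pockets `C(S) = W'` indexed by `W'` disjoint from `A`,
  two-point factors `μ_{G⁰}(· ↔ b in W'ᶜ)`): re-index `W = insert o W'`; pockets `W' ∋ o` are null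
  because the star of `o` is closed `G⁰/S`-a.s.; and `μ_{G⁰}(x ↔ b in W'ᶜ) = μ(x ↔ b in Wᶜ)`
  because an open path off the closed star never visits `o` (`goodStep24_openConnIn_of_starClosed`).
* `goodStep24_clean_singleton` — a singleton layer `S = {y}`: the clean inequality IS
  Kozma–Nitzan goodness `GOOD(G⁰, A, y, b)` (the induction hypothesis of `stub_goodStep`) at its
  tightest level, with the relay `a₀ = argmin_A μ_{G⁰}(· ↔ b)`.
Layers with `|S| ≥ 2` are exactly the new kernel GLUE-GOOD (siege k24 NOTES): not proved here.
No new definitions.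
-/

namespace Summit.CriticalPhenomena.PercolationContinuityZ3.Theorems

open MeasureTheory Set
open Literature.Probability.LatticeModels (prodBernoulli)
open Literature.Probability.Percolation (BondConfig openConn openConnIn openGraph openCluster)
open scoped BigOperators

noncomputable section
open Classical

section GoodStep24GlueAux

open Filter
open Literature.Probability.LatticeModels Literature.Probability.Percolation

variable {n : ℕ}

/-- `{x ↔ y in T}` is monotone in `T`. [folklore] -/
theorem goodStep24_openConnIn_mono {T T' : Set (Fin n)} (h : T ⊆ T') (x y : Fin n) :
    (openConnIn T x y : Set (BondConfig (Fin n))) ⊆ openConnIn T' x y := by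
  rintro ω ⟨hx, hy, hr⟩
  exact ⟨h hx, h hy, hr.map (SimpleGraph.induceHomOfLE (G := openGraph ω) h).toHom⟩

/-- If no pair at `o` is open, an open path inside `T'` from a vertex of `T ⊇ T' ∖ {o}` stays
inside `T`. [folklore] -/
theorem goodStep24_openConnIn_of_starClosed {ω : BondConfig (Fin n)} {o x b : Fin n}
    {T T' : Set (Fin n)} (hstar : ∀ z : Fin n, s(o, z) ∉ ω) (hT : ∀ q ∈ T', q ≠ o → q ∈ T)
    (hxT : x ∈ T) (h : ω ∈ openConnIn T' x b) : ω ∈ openConnIn T x b := by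
  obtain ⟨_, hr⟩ := DCT16.pathIn_of_mem_openConnIn h
  clear h
  refine DCT16.mem_openConnIn_of_pathIn ⟨hxT, ?_⟩
  induction hr with
  | refl => exact Relation.ReflTransGen.refl
  | @tail p q _ hpq ih =>
    refine ih.tail ⟨hpq.1, hT q hpq.2 fun hqo => ?_⟩
    have hadj := (openGraph_adj ω p q).1 hpq.1
    rw [hqo, Sym2.eq_swap] at hadj
    exact hstar p hadj.1

/-- Under a weighting vanishing on every pair at `o`, a.s. no pair at `o` is open. [folklore] -/
theorem goodStep24_ae_starClosed (K : Sym2 (Fin n) → unitInterval) (o : Fin n)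
    (hK : ∀ z : Fin n, K s(o, z) = 0) :
    ∀ᵐ ω ∂prodBernoulli K, ∀ z : Fin n, s(o, z) ∉ ω :=
  ae_all_iff.2 fun z => prodBernoulli_ae_notMem K (hK z)

/-- Under a weighting vanishing on the star of `o`: `μ(x ↔ b in W'ᶜ) = μ(x ↔ b in (insert o W')ᶜ)`
for `x ≠ o` (adding the isolated vertex `o` to the forbidden set costs nothing). [folklore] -/
theorem goodStep24_real_openConnIn_insert (K : Sym2 (Fin n) → unitInterval) (o x b : Fin n)
    (W' : Finset (Fin n)) (hK : ∀ z : Fin n, K s(o, z) = 0) (hxo : x ≠ o) :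
    (prodBernoulli K).real (openConnIn ((W' : Set (Fin n))ᶜ) x b) =
      (prodBernoulli K).real (openConnIn ((↑(insert o W') : Set (Fin n))ᶜ) x b) := by
  refine measureReal_congr ?_
  filter_upwards [goodStep24_ae_starClosed K o hK] with ω hω
  refine propext ⟨fun h => ?_, fun h => goodStep24_openConnIn_mono (fun q hq => ?_) x b h⟩
  · have hxW' : x ∉ W' := fun hx => h.1 (Finset.mem_coe.2 hx)
    refine goodStep24_openConnIn_of_starClosed hω (fun q hq hqo => ?_) ?_ h
    · rw [Set.mem_compl_iff, Finset.mem_coe, Finset.mem_insert, not_or]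
      exact ⟨hqo, fun hqW => hq (Finset.mem_coe.2 hqW)⟩
    · rw [Set.mem_compl_iff, Finset.mem_coe, Finset.mem_insert, not_or]
      exact ⟨hxo, hxW'⟩
  · rw [Set.mem_compl_iff, Finset.mem_coe] at hq ⊢
    exact fun hqW => hq (Finset.mem_insert_of_mem hqW)

/-- Under a weighting vanishing on the star of `o`, a block `S ∌ o` is a.s. not joined to `o`:
the event "the vertices joined to `S` are exactly `W'`" is null when `o ∈ W'`. [folklore] -/
theorem goodStep24_block_null (K : Sym2 (Fin n) → unitInterval) (o : Fin n) (S W' : Finset (Fin n))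
    (hK : ∀ z : Fin n, K s(o, z) = 0) (hoS : o ∉ S) (hoW' : o ∈ W') :
    (prodBernoulli K).real
      {ω : BondConfig (Fin n) | ∀ x : Fin n, (x ∈ W' ↔ ω ∈ ⋃ s ∈ S, openConn s x)} = 0 := by
  rw [← measureReal_empty (μ := prodBernoulli K)]
  refine measureReal_congr ?_
  filter_upwards [goodStep24_ae_starClosed K o hK] with ω hω
  refine propext ⟨fun h => ?_, fun h => False.elim h⟩
  obtain ⟨s, hs, hso⟩ := Set.mem_iUnion₂.1 ((h o).1 hoW')
  have hso' : (openGraph ω).Reachable o s := SimpleGraph.Reachable.symm hso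
  obtain ⟨z, -, hz, -⟩ := goodBase_exists_open_pair hso' fun h => hoS (h ▸ hs)
  exact hω z hz

/-- **The empty layer.**  If `a₀` minimises `μ_K(· ↔ b)` over `A ∌ o`, `K` kills the star of `o`
and agrees with `w` off it, then the engine inequality of the empty layer holds:
`μ_K(a₀ ↔ b) ≤ 0 + Σ_W μ_K{∀ x ≠ o, x ∉ W} · μ_w(sel W ↔ b in Wᶜ)` (only `W = {o}` contributes,
and `μ_w(x ↔ b in {o}ᶜ) = μ_K(x ↔ b)`). [cite: KozmaNitzan2024, §3.2 (proof of Thm 4, p. 14)] -/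
theorem goodStep24_ker_empty (w K : Sym2 (Fin n) → unitInterval) (A : Finset (Fin n))
    (o b a₀ : Fin n) (sel : Finset (Fin n) → Fin n) (ho : o ∉ A) (hsel : ∀ W, sel W ∈ A)
    (hmin : ∀ a ∈ A, (prodBernoulli K).real (openConn a₀ b) ≤ (prodBernoulli K).real (openConn a b))
    (h1 : ∀ e ∈ (({o} : Set (Fin n))ᶜ).sym2, w e = K e) (h2 : ∀ z : Fin n, z ≠ o → K s(o, z) = 0) :
    (prodBernoulli K).real (openConn a₀ b) ≤
      (prodBernoulli K).real (⋃ s ∈ (∅ : Finset (Fin n)), openConn s b)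
        + ∑ W ∈ (Finset.univ : Finset (Finset (Fin n))).filter (fun W => o ∈ W ∧ Disjoint W A),
            (prodBernoulli K).real
                {ω : BondConfig (Fin n) | ∀ x : Fin n, x ≠ o →
                  (x ∈ W ↔ ω ∈ ⋃ s ∈ (∅ : Finset (Fin n)), openConn s x)}
              * (prodBernoulli w).real (openConnIn ((W : Set (Fin n))ᶜ) (sel W) b) := by
  have hempty : (⋃ s ∈ (∅ : Finset (Fin n)), openConn s b : Set (BondConfig (Fin n))) = ∅ := by simp
  rw [hempty, measureReal_empty, zero_add]
  have hoFl : ({o} : Finset (Fin n)) ∈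
      (Finset.univ : Finset (Finset (Fin n))).filter (fun W => o ∈ W ∧ Disjoint W A) := by
    simp [ho]
  refine le_trans ?_ (Finset.single_le_sum (fun W _ => mul_nonneg measureReal_nonneg
    measureReal_nonneg) hoFl)
  have huniv : {ω : BondConfig (Fin n) | ∀ x : Fin n, x ≠ o →
      (x ∈ ({o} : Finset (Fin n)) ↔ ω ∈ ⋃ s ∈ (∅ : Finset (Fin n)), openConn s x)} = Set.univ := by
    refine Set.eq_univ_of_forall fun ω x hx => ?_
    simp [hx]
  rw [huniv, probReal_univ, one_mul, Finset.coe_singleton,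
    lemma5AnyRelay_real_openConnIn_compl_eq w K o (sel {o}) b
      (fun h => ho (h ▸ hsel {o})) h1 h2]
  exact hmin _ (hsel {o})

/-- **A singleton layer**: Kozma–Nitzan goodness of `(K, A, y, b)` (selection form, all levels
and selections) gives the CLEAN glued-goodness inequality of the block `{y}` with the relay
`a₀ = argmin_A μ_K(· ↔ b)` and any selection. [cite: KozmaNitzan2024, §3.2 Definition p. 12] -/
theorem goodStep24_clean_singleton (K : Sym2 (Fin n) → unitInterval) (A : Finset (Fin n))
    (y b a₀ : Fin n) (sel' : Finset (Fin n) → Fin n) (hb : b ∈ A)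
    (hsel : ∀ W, sel' W ∈ A)
    (hmin : ∀ a ∈ A, (prodBernoulli K).real (openConn a₀ b) ≤ (prodBernoulli K).real (openConn a b))
    (hgood : ∀ (t : ℝ) (sel : Finset (Fin n) → Fin n), (∀ W, sel W ∈ A) →
      (∀ a ∈ A, 1 - t ≤ (prodBernoulli K).real (openConn a b)) →
      (prodBernoulli K).real ((⋃ a ∈ A, openConn y a) ∩ (openConn y b)ᶜ)
        + ∑ W ∈ (Finset.univ : Finset (Finset (Fin n))).filter (fun W => y ∈ W ∧ Disjoint W A),
            (prodBernoulli K).real {ω : BondConfig (Fin n) | openCluster ω y = (W : Set (Fin n))}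
              * (prodBernoulli K).real (openConnIn ((W : Set (Fin n))ᶜ) (sel W) b)ᶜ ≤ t) :
    (prodBernoulli (fun e : Sym2 (Fin n) =>
        if (∀ x ∈ e, x ∈ ({y} : Finset (Fin n))) ∧ ¬ e.IsDiag then 1 else K e)).real (openConn a₀ b) ≤
      (prodBernoulli (fun e : Sym2 (Fin n) =>
          if (∀ x ∈ e, x ∈ ({y} : Finset (Fin n))) ∧ ¬ e.IsDiag then 1 else K e)).real
          (⋃ s ∈ ({y} : Finset (Fin n)), openConn s b)
        + ∑ W' ∈ (Finset.univ : Finset (Finset (Fin n))).filter (fun W' => Disjoint W' A),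
            (prodBernoulli (fun e : Sym2 (Fin n) =>
                if (∀ x ∈ e, x ∈ ({y} : Finset (Fin n))) ∧ ¬ e.IsDiag then 1 else K e)).real
                {ω : BondConfig (Fin n) | ∀ x : Fin n,
                  (x ∈ W' ↔ ω ∈ ⋃ s ∈ ({y} : Finset (Fin n)), openConn s x)}
              * (prodBernoulli K).real (openConnIn ((W' : Set (Fin n))ᶜ) (sel' W') b) := by
  rw [goodStep24_glue_singleton K y]
  have h := hgood (1 - (prodBernoulli K).real (openConn a₀ b)) sel' hsel
    (fun a ha => by linarith [hmin a ha])
  rw [goodStep24_functional_eq K A y b hb sel'] at h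
  simp only [Finset.set_biUnion_singleton]
  have hset : ∀ W : Finset (Fin n), {ω : BondConfig (Fin n) | openCluster ω y = (W : Set (Fin n))} =
      {ω : BondConfig (Fin n) | ∀ x : Fin n, (x ∈ W ↔ ω ∈ openConn y x)} := by
    intro W
    ext ω
    simp only [Set.mem_setOf_eq]
    rw [Set.ext_iff]
    refine forall_congr' fun x => ?_
    rw [Finset.mem_coe]
    exact Iff.comm
  have hsum : ∑ W ∈ (Finset.univ : Finset (Finset (Fin n))).filter (fun W => y ∈ W ∧ Disjoint W A),
      (prodBernoulli K).real {ω : BondConfig (Fin n) | openCluster ω y = (W : Set (Fin n))}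
        * (prodBernoulli K).real (openConnIn ((W : Set (Fin n))ᶜ) (sel' W) b) ≤
      ∑ W' ∈ (Finset.univ : Finset (Finset (Fin n))).filter (fun W' => Disjoint W' A),
        (prodBernoulli K).real {ω : BondConfig (Fin n) | ∀ x : Fin n, (x ∈ W' ↔ ω ∈ openConn y x)}
          * (prodBernoulli K).real (openConnIn ((W' : Set (Fin n))ᶜ) (sel' W') b) := by
    simp only [hset]
    refine Finset.sum_le_sum_of_subset_of_nonneg (fun W hW => ?_) (fun W _ _ =>
      mul_nonneg measureReal_nonneg measureReal_nonneg)
    simp only [Finset.mem_filter, Finset.mem_univ, true_and] at hW ⊢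
    exact hW.2
  linarith

end GoodStep24GlueAux

open Filter Literature.Probability.LatticeModels Literature.Probability.Percolation in
/-- Registered helper stub `stub_goodStepBranch_k24` of crux stmt-CriticalPhenomena-4576 (siege k24,
for `stub_goodStep`): **from the clean glued-goodness inequality of a block to the engine's branch
inequality.**  `K` kills the star of `o` and agrees with `w` off it, `S ∌ o` is the glued block,
`g = K` with weight `1` on the non-loop pairs inside `S`.  If
`μ_g(a₀ ↔ b) ≤ μ_g(S ↔ b) + Σ_{W' ∩ A = ∅} μ_g{∀ x, x ∈ W' ↔ S ↔ x} · μ_K(sel (insert o W') ↔ b in W'ᶜ)`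
then
`μ_g(a₀ ↔ b) ≤ μ_g(S ↔ b) + Σ_{W ∋ o, W ∩ A = ∅} μ_g{∀ x ≠ o, x ∈ W ↔ S ↔ x} · μ_w(sel W ↔ b in Wᶜ)`.
[cite: KozmaNitzan2024, §3.2 (proofs of Thms 4–5, pp. 13–14)] -/
theorem stub_goodStepBranch_k24 :
    ∀ (n : ℕ) (w K : Sym2 (Fin n) → unitInterval) (A S : Finset (Fin n)) (o b a₀ : Fin n)
      (sel : Finset (Fin n) → Fin n),
      o ∉ A → o ∉ S → (∀ W, sel W ∈ A) → (∀ z : Fin n, K s(o, z) = 0) →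
      (∀ e : Sym2 (Fin n), o ∉ e → K e = w e) →
      (prodBernoulli (fun e : Sym2 (Fin n) =>
          if (∀ x ∈ e, x ∈ S) ∧ ¬ e.IsDiag then 1 else K e)).real (openConn a₀ b) ≤
        (prodBernoulli (fun e : Sym2 (Fin n) =>
            if (∀ x ∈ e, x ∈ S) ∧ ¬ e.IsDiag then 1 else K e)).real (⋃ s ∈ S, openConn s b)
          + ∑ W' ∈ (Finset.univ : Finset (Finset (Fin n))).filter (fun W' => Disjoint W' A),
              (prodBernoulli (fun e : Sym2 (Fin n) =>
                  if (∀ x ∈ e, x ∈ S) ∧ ¬ e.IsDiag then 1 else K e)).real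
                  {ω : BondConfig (Fin n) | ∀ x : Fin n, (x ∈ W' ↔ ω ∈ ⋃ s ∈ S, openConn s x)}
                * (prodBernoulli K).real
                    (openConnIn ((W' : Set (Fin n))ᶜ) (sel (insert o W')) b) →
      (prodBernoulli (fun e : Sym2 (Fin n) =>
          if (∀ x ∈ e, x ∈ S) ∧ ¬ e.IsDiag then 1 else K e)).real (openConn a₀ b) ≤
        (prodBernoulli (fun e : Sym2 (Fin n) =>
            if (∀ x ∈ e, x ∈ S) ∧ ¬ e.IsDiag then 1 else K e)).real (⋃ s ∈ S, openConn s b)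
          + ∑ W ∈ (Finset.univ : Finset (Finset (Fin n))).filter (fun W => o ∈ W ∧ Disjoint W A),
              (prodBernoulli (fun e : Sym2 (Fin n) =>
                  if (∀ x ∈ e, x ∈ S) ∧ ¬ e.IsDiag then 1 else K e)).real
                  {ω : BondConfig (Fin n) | ∀ x : Fin n, x ≠ o →
                    (x ∈ W ↔ ω ∈ ⋃ s ∈ S, openConn s x)}
                * (prodBernoulli w).real (openConnIn ((W : Set (Fin n))ᶜ) (sel W) b) := by
  intro n w K A S o b a₀ sel ho hoS hsel hK hKw hclean
  set g : Sym2 (Fin n) → unitInterval :=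
    fun e => if (∀ x ∈ e, x ∈ S) ∧ ¬ e.IsDiag then 1 else K e with hg
  refine hclean.trans (add_le_add le_rfl ?_)
  -- the glued weighting also kills the star of `o`
  have hgK : ∀ z : Fin n, g s(o, z) = 0 := by
    intro z
    have hne : ¬ ((∀ x ∈ s(o, z), x ∈ S) ∧ ¬ (s(o, z)).IsDiag) := fun h =>
      hoS (h.1 o (Sym2.mem_mk_left o z))
    simp only [hg]
    rw [if_neg hne, hK z]
  set Fl := (Finset.univ : Finset (Finset (Fin n))).filter (fun W => o ∈ W ∧ Disjoint W A) with hFl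
  set Fl' := (Finset.univ : Finset (Finset (Fin n))).filter (fun W' => Disjoint W' A) with hFl'
  set f : Finset (Fin n) → ℝ := fun W' =>
    (prodBernoulli g).real {ω : BondConfig (Fin n) | ∀ x : Fin n, (x ∈ W' ↔ ω ∈ ⋃ s ∈ S, openConn s x)}
      * (prodBernoulli K).real (openConnIn ((W' : Set (Fin n))ᶜ) (sel (insert o W')) b) with hf
  set gW : Finset (Fin n) → ℝ := fun W =>
    (prodBernoulli g).real {ω : BondConfig (Fin n) | ∀ x : Fin n, x ≠ o →
        (x ∈ W ↔ ω ∈ ⋃ s ∈ S, openConn s x)}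
      * (prodBernoulli w).real (openConnIn ((W : Set (Fin n))ᶜ) (sel W) b) with hgW
  show ∑ W' ∈ Fl', f W' ≤ ∑ W ∈ Fl, gW W
  -- pockets containing `o` are null
  have hnull : ∀ W' ∈ Fl', o ∈ W' → f W' = 0 := by
    intro W' _ hoW'
    simp only [hf]
    rw [goodStep24_block_null g o S W' hgK hoS hoW', zero_mul]
  -- termwise comparison on the pockets avoiding `o`
  have hterm : ∀ W' ∈ Fl'.filter (fun W' => o ∉ W'), f W' ≤ gW (insert o W') := by
    intro W' hW'
    obtain ⟨-, hoW'⟩ := Finset.mem_filter.1 hW'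
    simp only [hf, hgW]
    have hxo : sel (insert o W') ≠ o := fun h => ho (h ▸ hsel _)
    have h2 : (prodBernoulli K).real (openConnIn ((W' : Set (Fin n))ᶜ) (sel (insert o W')) b) =
        (prodBernoulli w).real (openConnIn ((↑(insert o W') : Set (Fin n))ᶜ) (sel (insert o W')) b) := by
      rw [goodStep24_real_openConnIn_insert K o _ b W' hK hxo]
      refine goodStep24_real_openConnIn_eq K w o Finset.univ (insert o W')
        (Finset.mem_insert_self o W') _ b fun e he => hKw e fun hoe => he ?_
      obtain ⟨z, rfl⟩ := Sym2.mem_iff_exists.1 hoe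
      exact ⟨z, Finset.mem_univ _, rfl⟩
    rw [h2]
    refine mul_le_mul_of_nonneg_right (measureReal_mono (fun ω hω x hx => ?_) (measure_ne_top _ _))
      measureReal_nonneg
    rw [Finset.mem_insert]
    exact ⟨fun h => (hω x).1 (h.resolve_left hx), fun h => Or.inr ((hω x).2 h)⟩
  calc ∑ W' ∈ Fl', f W'
      = ∑ W' ∈ Fl'.filter (fun W' => o ∉ W'), f W' := by
        rw [← Finset.sum_filter_add_sum_filter_not Fl' (fun W' => o ∉ W')]
        rw [Finset.sum_eq_zero (s := Fl'.filter fun W' => ¬ o ∉ W') fun W' hW' => ?_, add_zero]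
        obtain ⟨hW'Fl, hoW'⟩ := Finset.mem_filter.1 hW'
        exact hnull W' hW'Fl (not_not.1 hoW')
    _ ≤ ∑ W' ∈ Fl'.filter (fun W' => o ∉ W'), gW (insert o W') := Finset.sum_le_sum hterm
    _ = ∑ W ∈ (Fl'.filter (fun W' => o ∉ W')).image (insert o), gW W := by
        rw [Finset.sum_image]
        intro W₁ hW₁ W₂ hW₂ hins
        have h1 : o ∉ W₁ := (Finset.mem_filter.1 hW₁).2
        have h2 : o ∉ W₂ := (Finset.mem_filter.1 hW₂).2
        rw [← Finset.erase_insert h1, hins, Finset.erase_insert h2]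
    _ ≤ ∑ W ∈ Fl, gW W := by
        refine Finset.sum_le_sum_of_subset_of_nonneg (fun W hW => ?_)
          fun W _ _ => mul_nonneg measureReal_nonneg measureReal_nonneg
        obtain ⟨W', hW', rfl⟩ := Finset.mem_image.1 hW
        obtain ⟨hW'Fl, -⟩ := Finset.mem_filter.1 hW'
        have hdisj : Disjoint W' A := (Finset.mem_filter.1 hW'Fl).2
        simp only [hFl, Finset.mem_filter, Finset.mem_univ, true_and, Finset.mem_insert_self]
        rw [Finset.disjoint_insert_left]
        exact ⟨ho, hdisj⟩

end

end Summit.CriticalPhenomena.PercolationContinuityZ3.Theorems
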